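import Literature.MathematicalPhysics.KineticTheory.LangevinChainDegenerateHormanderLift
import Literature.MathematicalPhysics.KineticTheory.LangevinChainForwardEquation
import Literature.MathematicalPhysics.KineticTheory.ReyBelletThomas2002TransitionDensity
import HarnessLib

/-!
# The Langevin chain: transition densities smooth in `(t, y)`, from Hörmander's theorem (CEHR Prop. 3.2, part)

Topic `Literature/MathematicalPhysics/KineticTheory`. Cuneo–Eckmann–Hairer–Rey-Bellet 2018,
Prop. 3.2: "the transition probabilities `P_t(z, dz')` have a density `p_t(z, z')` … smooth …
This is a well-known consequence of Hörmander's theorem". For an oscillator chain `P` with smooth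
potentials whose coupling is RB-non-degenerate (`RBNondegenerate P.V`, e.g. `V = r⁴/4`), `γ > 0`,
`N ≥ 1`, `T_L > 0`, `T_R ≥ 0`, EVERY `S : MarkovSemigroupFor (P.generator N T_L T_R)` (Markov,
Chapman–Kolmogorov, Dynkin on `C_c^∞` for the generator (3.2) — in particular the constructed
transition semigroups) and every starting point `x`, this file proves the `(t, y)`-part of the
smoothness, porting `ReyBelletThomas2002TransitionDensity.lean` (there for the Rey-Bellet–Thomas
model) to the Langevin baths:

* `OscillatorChain.generator_eq_hormanderOp` — the generator in Hörmander's form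
  `L = X_L² + X_R² + Y` (`X_b = √(γT_b) ∂_{p_b}`, `Y` the drift);
* `OscillatorChain.hormanderTranspose_langevinParabolic` — `ᵗP̃ Ψ = ∂_tΨ + L_yΨ` for the parabolic
  operator `P̃ = X̃_L² + X̃_R² + X̃₀ + 2γ` of `langevinParabolicFamily`;
* `OscillatorChain.langevin_transitionDensity_of_hormander` — **there is `p ∈ C^∞((0,∞) × Ω)`,
  `p ≥ 0`, with `P_t(x, dy) = p(t, y) dy` for every `t > 0`**: the space-time law
  `dt ⊗ P_t(x, dy)` (`MarkovSemigroupFor.spaceTimeLaw`) solves `P̃ u = 0` in `𝓓'((0,∞) × Ω)` by the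
  forward equation (`langevin_forwardEquation`), the parabolic family is bracket generating
  (`isBracketGenerating_langevinParabolicFamily`), Hörmander's Theorem 1.1 (the hypothesis `hH`,
  proved in the tree as `Literature.Analysis.Hypoelliptic.hormander1967_thm11_proof`) gives a
  smooth density, and slicing in `t` identifies `P_t(x, ·)`.

The joint regularity in the starting point `x` is the subject of `LangevinChainJointDensity.lean`.

## References

* N. Cuneo, J.-P. Eckmann, M. Hairer, L. Rey-Bellet, EJP 23 (2018) no. 55 (arXiv:1712.09413),
  Prop. 3.2 and eq. (3.2).
* L. Hörmander, Acta Math. 119 (1967) 147–171, Thm 1.1.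
-/

noncomputable section

open MeasureTheory ProbabilityTheory Filter Topology Set TopologicalSpace
open scoped NNReal ENNReal ContDiff Distributions

namespace Literature.MathematicalPhysics.KineticTheory.HeatConduction

open Literature.Analysis.Distribution Literature.MathematicalPhysics.KineticTheory

variable {N : ℕ}

/-! ### The generator in Hörmander's form and the transpose of the parabolic operator -/

namespace OscillatorChain

variable (P : OscillatorChain)

/-- **`L = X_L² + X_R² + Y`**: for `N ≥ 1`, `γT_L, γT_R ≥ 0` and `f ∈ C^∞`, the generator (3.2) is
Hörmander's operator with drift `Y = P.drift N`, the constant fields `X_b = √(γT_b) ∂_{p_b}` of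
`bathField` and `c = 0` (`X_b² f = γT_b ∂²_{p_b} f`).
[cite: CuneoEckmannHairerReyBellet2018, §3 eq. (3.2)] -/
theorem generator_eq_hormanderOp (hN : 0 < N) {T_L T_R : ℝ} (hL : 0 ≤ P.γ * T_L)
    (hR : 0 ≤ P.γ * T_R) {f : PhaseSpace N → ℝ} (hf : ContDiff ℝ ∞ f) (x : PhaseSpace N) :
    P.generator N T_L T_R f x = hormanderOp (P.drift N) (P.bathField hN T_L T_R) (fun _ => 0) f x := by
  have hf2 : ContDiff ℝ 2 f := hf.of_le (by norm_cast)
  rw [generator_eq_fderiv_add_half P hN hL hR hf2 x, hormanderOp, Fin.sum_univ_two]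
  simp only [zero_mul, add_zero]
  have hN1 : N - 1 < N := Nat.sub_lt hN one_pos
  -- the two constant noise fields
  have hsq : ∀ (b : Fin 2), fieldDeriv (P.bathField hN T_L T_R b)
      (fieldDeriv (P.bathField hN T_L T_R b) f) x =
      P.γ * bathTemp T_L T_R b *
        fderiv ℝ (fderiv ℝ f) x (unitP (bathSite hN b)) (unitP (bathSite hN b)) := by
    intro b
    have hTb : 0 ≤ P.γ * bathTemp T_L T_R b := by
      fin_cases b
      · exact hL
      · exact hR
    set c := Real.sqrt (P.γ * bathTemp T_L T_R b) with hc
    have e1 : P.bathField hN T_L T_R b = fun _ => c • (unitP (bathSite hN b) : PhaseSpace N) := rfl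
    rw [e1]
    show fderiv ℝ (fun y => fderiv ℝ f y (c • unitP (bathSite hN b))) x (c • unitP (bathSite hN b)) = _
    rw [fderiv_fderiv_apply_const hf2, map_smul, map_smul, FunLike.coe_smul,
      Pi.smul_apply, smul_eq_mul, smul_eq_mul, ← mul_assoc, hc, Real.mul_self_sqrt hTb]
  have hhalf : ∀ (k : ℕ) (hk : k < N) (T : ℝ), 0 ≤ P.γ * T →
      (1 / 2 : ℝ) * fderiv ℝ (fderiv ℝ f) x (bathVec N k (Real.sqrt (2 * P.γ * T)))
        (bathVec N k (Real.sqrt (2 * P.γ * T))) =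
      P.γ * T * fderiv ℝ (fderiv ℝ f) x (unitP ⟨k, hk⟩) (unitP ⟨k, hk⟩) := by
    intro k hk T hT
    rw [bathVec_eq_smul_unitP hk, map_smul, map_smul, FunLike.coe_smul, Pi.smul_apply,
      smul_eq_mul, smul_eq_mul, ← mul_assoc, ← mul_assoc,
      show (1 / 2 : ℝ) * Real.sqrt (2 * P.γ * T) * Real.sqrt (2 * P.γ * T) = P.γ * T by
        rw [mul_assoc, Real.mul_self_sqrt (by nlinarith)]; ring]
  rw [mul_add, hhalf 0 hN T_L hL, hhalf (N - 1) hN1 T_R hR, hsq 0, hsq 1]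
  simp only [bathTemp, bathSite, Matrix.cons_val_zero, Matrix.cons_val_one, fieldDeriv_apply]
  ring

/-- **`ᵗP̃ Ψ = ∂_tΨ + L_yΨ`** for the parabolic Hörmander operator
`P̃ = X̃_L² + X̃_R² + X̃₀ + 2γ` of the family `langevinParabolicFamily` (`X̃_b = (0, X_b)` constant,
`X̃₀ = (-1, -Y)`, `div X̃₀ = div(-Y) = 2γ`), smooth potentials, `N ≥ 1`, `γT_b ≥ 0`, `Ψ ∈ C^∞(ℝ × Ω)`.
[cite: CuneoEckmannHairerReyBellet2018, Prop 3.2] -/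
theorem hormanderTranspose_langevinParabolic (hU : ContDiff ℝ ∞ P.U) (hV : ContDiff ℝ ∞ P.V)
    (hN : 0 < N) {T_L T_R : ℝ} (hL : 0 ≤ P.γ * T_L) (hR : 0 ≤ P.γ * T_R)
    {Ψ : ℝ × PhaseSpace N → ℝ} (hΨ : ContDiff ℝ ∞ Ψ) (p : ℝ × PhaseSpace N) :
    hormanderTranspose (P.langevinParabolicFamily hN T_L T_R none)
        (fun b => P.langevinParabolicFamily hN T_L T_R (some b)) (fun _ => 2 * P.γ) Ψ p =
      fderiv ℝ Ψ p (1, 0) + P.generator N T_L T_R (fun y => Ψ (p.1, y)) p.2 := by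
  obtain ⟨t, y⟩ := p
  have hΨ2 : ContDiff ℝ 2 Ψ := hΨ.of_le (by norm_cast)
  have hΨd : Differentiable ℝ Ψ := hΨ.differentiable (by simp)
  have hft : ContDiff ℝ ∞ (fun y' => Ψ (t, y')) := hΨ.comp (contDiff_const.prodMk contDiff_id)
  have hft2 : ContDiff ℝ 2 (fun y' => Ψ (t, y')) := hft.of_le (by norm_cast)
  rw [P.generator_eq_hormanderOp hN hL hR hft y, hormanderTranspose, hormanderOp]
  -- the noise fields: constant lifts
  have hb : ∀ b : Fin 2,
      fieldTranspose (P.langevinParabolicFamily hN T_L T_R (some b))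
        (fieldTranspose (P.langevinParabolicFamily hN T_L T_R (some b)) Ψ) (t, y) =
      fieldDeriv (P.bathField hN T_L T_R b)
        (fieldDeriv (P.bathField hN T_L T_R b) fun y' => Ψ (t, y')) y := by
    intro b
    set v : PhaseSpace N := P.bathField hN T_L T_R b y with hv
    have e1 : P.langevinParabolicFamily hN T_L T_R (some b) = fun _ => ((0 : ℝ), v) := by
      funext q; rfl
    have e3 : fieldDeriv (P.bathField hN T_L T_R b)
        (fieldDeriv (P.bathField hN T_L T_R b) fun y' => Ψ (t, y')) y =
        fderiv ℝ (fun y' => fderiv ℝ (fun y'' => Ψ (t, y'')) y' v) y v := rfl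
    rw [e1, fieldTranspose_fieldTranspose_const_apply, e3, fderiv_fderiv_apply_const hft2,
      fderiv_fderiv_spaceSlice_apply hΨ2 t y]
  -- the drift
  have h0 : fieldTranspose (P.langevinParabolicFamily hN T_L T_R none) Ψ (t, y) =
      fderiv ℝ Ψ (t, y) (1, 0) + fieldDeriv (P.drift N) (fun y' => Ψ (t, y')) y -
        2 * P.γ * Ψ (t, y) := by
    have hdiv : fieldDiv (P.langevinParabolicFamily hN T_L T_R none) (t, y) = 2 * P.γ := by
      have e1 : P.langevinParabolicFamily hN T_L T_R none = liftField (-1) fun y' => -P.drift N y' := rfl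
      have hXd : Differentiable ℝ (P.drift N) := (P.contDiff_drift hU hV N).differentiable (by simp)
      have hXd' : DifferentiableAt ℝ (fun y' => -P.drift N y') y := (hXd y).neg
      rw [e1, fieldDiv_liftField (-1) (p := (t, y)) hXd']
      show LinearMap.trace ℝ _ (fderiv ℝ (fun y' => -P.drift N y') y : PhaseSpace N →ₗ[ℝ] PhaseSpace N) = _
      rw [fderiv_fun_neg]
      simp only [ContinuousLinearMap.toLinearMap_neg, map_neg]
      rw [show LinearMap.trace ℝ _ (fderiv ℝ (P.drift N) y : PhaseSpace N →ₗ[ℝ] PhaseSpace N)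
        = fieldDiv (P.drift N) y from rfl, P.fieldDiv_drift hU hV hN]
      ring
    rw [fieldTranspose, hdiv, fieldDeriv, fieldDeriv, langevinParabolicFamily_none]
    have e2 : ((-1 : ℝ), P.adjointDrift N y) = -(((1 : ℝ), (0 : PhaseSpace N)) + ((0 : ℝ), P.drift N y)) := by
      simp [adjointDrift]
    rw [show ((t, y) : ℝ × PhaseSpace N).2 = y from rfl, e2, map_neg, map_add,
      fderiv_spaceSlice_apply hΨd t y]
    ring
  rw [Finset.sum_congr rfl fun b _ => hb b, h0]
  simp only [zero_mul, add_zero]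
  ring

end OscillatorChain

/-! ### Transition densities smooth in `(t, y)` -/

namespace OscillatorChain

variable (P : OscillatorChain)

/-- `t ↦ P_t b(x)` is continuous on `(0, ∞)` for `b ∈ C_c^∞` (Lipschitz, Dynkin). [folklore] -/
theorem langevin_continuousOn_act_of_smooth (hU : ContDiff ℝ 1 P.U) (hV : ContDiff ℝ 1 P.V)
    {T_L T_R : ℝ} (S : MarkovSemigroupFor (P.generator N T_L T_R)) {b : PhaseSpace N → ℝ}
    (hb : ContDiff ℝ ∞ b) (hbc : HasCompactSupport b) (x : PhaseSpace N) :
    ContinuousOn (fun t : ℝ => S.act t.toNNReal b x) (Ioi 0) := by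
  have hb2 : ContDiff ℝ 2 b := hb.of_le (by norm_cast)
  obtain ⟨C, hC⟩ := P.exists_bound_generator hU hV N T_L T_R hb2 hbc
  have hLc := P.continuous_generator hU hV N T_L T_R hb2
  have hC0 : 0 ≤ C := (norm_nonneg _).trans (hC x)
  refine Metric.continuousOn_iff.2 fun t ht ε hε => ⟨ε / (C + 1), by positivity, fun s hs hst => ?_⟩
  rw [Real.dist_eq] at hst ⊢
  have h := S.abs_act_sub_act_le hb hbc hLc hC s.toNNReal t.toNNReal x
  rw [Real.coe_toNNReal _ (le_of_lt hs), Real.coe_toNNReal _ (le_of_lt ht)] at h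
  calc |S.act s.toNNReal b x - S.act t.toNNReal b x| ≤ C * |s - t| := h
    _ ≤ C * (ε / (C + 1)) := mul_le_mul_of_nonneg_left hst.le hC0
    _ = ε * (C / (C + 1)) := by ring
    _ < ε := mul_lt_of_lt_one_right hε ((div_lt_one (by positivity)).2 (by linarith))

/-- **Transition densities of the Langevin chain, smooth in `(t, y)`, from Hörmander's
Theorem 1.1** (CEHR Prop. 3.2, `(t, y)`-part): for smooth potentials with RB-non-degenerate
coupling, `γ > 0`, `N ≥ 1`, `T_L > 0`, `T_R ≥ 0`, every `S : MarkovSemigroupFor (P.generator N T_L T_R)`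
and every `x`, there is
`p ∈ C^∞((0,∞) × X)`, `p ≥ 0` there, with `P_t(x, dy) = p(t, y) dy` for every `t > 0`. Proof: the
space-time law `dt ⊗ P_t(x, dy)` solves `P̃ u = 0` in `𝓓'((0,∞) × X)` for the parabolic
Hörmander operator `P̃` (`ᵗP̃ = ∂_t + L_y`, forward equation), whose family is bracket generating;
hypoellipticity gives a smooth density on `(0,∞) × X`; slicing in `t` (a.e. `t` by testing
products, then every `t` by continuity in `t` of both sides) identifies `P_t(x, ·)`.
[cite: CuneoEckmannHairerReyBellet2018, Prop 3.2] [cite: Hormander1967, Thm 1.1] -/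
theorem langevin_transitionDensity_of_hormander (hH : Hormander1967_thm11) (hU : ContDiff ℝ ∞ P.U)
    (hV : ContDiff ℝ ∞ P.V) (hV2 : RBNondegenerate P.V) (hγ : 0 < P.γ) (hN : 0 < N)
    {T_L T_R : ℝ} (hL : 0 < T_L) (hR : 0 ≤ T_R) (S : MarkovSemigroupFor (P.generator N T_L T_R))
    (x : PhaseSpace N) :
    ∃ p : ℝ → PhaseSpace N → ℝ,
      ContDiffOn ℝ ∞ (fun w : ℝ × PhaseSpace N => p w.1 w.2) (Set.Ioi (0 : ℝ) ×ˢ Set.univ) ∧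
      (∀ t : ℝ, 0 < t → ∀ y, 0 ≤ p t y) ∧
      ∀ t : ℝ≥0, 0 < t →
        S.kernel t x = (volume : Measure (PhaseSpace N)).withDensity fun y => ENNReal.ofReal (p t y) := by
  haveI := isAddHaarMeasure_volume_phaseSpace N
  haveI : (volume : Measure (ℝ × PhaseSpace N)).IsAddHaarMeasure :=
    Measure.prod.instIsAddHaarMeasure _ _
  have hγL : 0 < P.γ * T_L := mul_pos hγ hL
  have hγR : 0 ≤ P.γ * T_R := mul_nonneg hγ.le hR
  -- the parabolic family, its smoothness and bracket condition
  set X₀ : ℝ × PhaseSpace N → ℝ × PhaseSpace N := P.langevinParabolicFamily hN T_L T_R none with hX₀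
  set Xb : Fin 2 → ℝ × PhaseSpace N → ℝ × PhaseSpace N :=
    fun b => P.langevinParabolicFamily hN T_L T_R (some b) with hXb
  have hfam : (fun o : Option (Fin 2) => o.elim X₀ Xb) = P.langevinParabolicFamily hN T_L T_R := by
    funext o; cases o <;> rfl
  have hX₀s : ContDiff ℝ ∞ X₀ := P.contDiff_langevinParabolicFamily hU hV hN T_L T_R none
  have hXbs : ∀ b, ContDiff ℝ ∞ (Xb b) := fun b => P.contDiff_langevinParabolicFamily hU hV hN T_L T_R (some b)
  have hbr : IsBracketGenerating (fun o : Option (Fin 2) => o.elim X₀ Xb)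
      ((⊤ : Opens (ℝ × PhaseSpace N)) : Set (ℝ × PhaseSpace N)) := by
    rw [hfam, Opens.coe_top]
    exact P.isBracketGenerating_langevinParabolicFamily hU hV hN hV2 hγL
  have hyp := hH (ℝ × PhaseSpace N) volume (Fin 2) ⊤ X₀ Xb (fun _ => 2 * P.γ) hX₀s hXbs
    contDiff_const hbr
  -- the space-time law solves `P̃ u = 0` on `(0, ∞) × X`
  set U : Set (ℝ × PhaseSpace N) := Set.Ioi (0 : ℝ) ×ˢ Set.univ with hUdef
  have hUo : IsOpen U := isOpen_Ioi.prod isOpen_univ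
  have himg : Literature.Analysis.Distribution.ImageIsSmoothOn (measureDistribution (S.spaceTimeLaw x) ⊤)
      (hormanderTranspose X₀ Xb fun _ => 2 * P.γ) volume U := by
    refine ⟨0, contDiffOn_const, fun φ ψ hφU hψ => ?_⟩
    rw [measureDistribution_apply]
    simp only [Pi.zero_apply, zero_mul, integral_zero]
    have hψ' : ∀ q, ψ q = fderiv ℝ φ q (1, 0) + P.generator N T_L T_R (fun y => φ (q.1, y)) q.2 := by
      intro q
      have := congrFun hψ q
      rw [this]
      exact P.hormanderTranspose_langevinParabolic hU hV hN hγL.le hγR φ.contDiff q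
    have hint : Integrable (fun q => (ψ : ℝ × PhaseSpace N → ℝ) q) (S.spaceTimeLaw x) :=
      ψ.contDiff.continuous.integrable_of_hasCompactSupport ψ.hasCompactSupport
    rw [S.integral_spaceTimeLaw x hint]
    simp only [hψ']
    exact P.langevin_forwardEquation hU hV hN hγL.le hγR S φ.contDiff φ.hasCompactSupport hφU x
  obtain ⟨g, hg, hgint⟩ := hyp (measureDistribution (S.spaceTimeLaw x) ⊤) U hUo (subset_univ _) himg
  -- the density and its slices
  refine ⟨fun t y => g (t, y), hg, ?_⟩
  have hgc : ContinuousOn g U := hg.continuousOn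
  have hslice_cont : ∀ t : ℝ, 0 < t → Continuous fun y => g (t, y) := fun t ht =>
    (hgc.comp_continuous (Continuous.prodMk_right t) fun y => ⟨ht, mem_univ _⟩)
  -- testing products `a(t) b(y)`
  have hkey : ∀ {b : PhaseSpace N → ℝ}, ContDiff ℝ ∞ b → HasCompactSupport b →
      ∀ t : ℝ, 0 < t → S.act t.toNNReal b x = ∫ y, g (t, y) * b y := by
    intro b hb hbc
    -- both sides are continuous on `(0, ∞)`
    set Fb : ℝ → ℝ := fun t => S.act t.toNNReal b x with hFb
    set Gb : ℝ → ℝ := fun t => ∫ y, g (t, y) * b y with hGb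
    have hFc : ContinuousOn Fb (Ioi 0) :=
      P.langevin_continuousOn_act_of_smooth (hU.of_le (by norm_cast)) (hV.of_le (by norm_cast)) S hb hbc x
    have hbi : Integrable b volume := hb.continuous.integrable_of_hasCompactSupport hbc
    have hGc : ContinuousOn Gb (Ioi 0) := by
      intro t₀ ht₀
      have ht₀' : (0 : ℝ) < t₀ := ht₀
      have ht₀2 : 0 < t₀ / 2 := by linarith
      -- a uniform bound of `g` on `[t₀/2, t₀+1] × tsupport b`
      have hK : IsCompact (Icc (t₀ / 2) (t₀ + 1) ×ˢ tsupport b) := isCompact_Icc.prod hbc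
      have hKU : Icc (t₀ / 2) (t₀ + 1) ×ˢ tsupport b ⊆ U := fun q hq =>
        ⟨lt_of_lt_of_le ht₀2 hq.1.1, mem_univ _⟩
      obtain ⟨M, hM⟩ := hK.exists_bound_of_continuousOn (hgc.mono hKU)
      refine (continuousAt_of_dominated (bound := fun y => max M 0 * ‖b y‖) ?_ ?_
        (hbi.norm.const_mul _) ?_).continuousWithinAt
      · filter_upwards [Ioi_mem_nhds ht₀] with t ht
        exact ((hslice_cont t ht).mul hb.continuous).aestronglyMeasurable
      · filter_upwards [Ioo_mem_nhds (show t₀ / 2 < t₀ by linarith) (show t₀ < t₀ + 1 by linarith)]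
          with t ht
        refine Eventually.of_forall fun y => ?_
        rw [norm_mul]
        by_cases hy : y ∈ tsupport b
        · exact mul_le_mul_of_nonneg_right ((hM (t, y) ⟨⟨ht.1.le, ht.2.le⟩, hy⟩).trans
            (le_max_left _ _)) (norm_nonneg _)
        · rw [image_eq_zero_of_notMem_tsupport hy, norm_zero, mul_zero, mul_zero]
      · refine Eventually.of_forall fun y => ?_
        have hga : ContinuousAt g (t₀, y) := hgc.continuousAt (hUo.mem_nhds ⟨ht₀, mem_univ _⟩)
        exact ((ContinuousAt.comp (f := fun t : ℝ => (t, y)) (x := t₀) hga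
          (Continuous.prodMk_left y).continuousAt).mul continuousAt_const)
    -- testing against `a(t) b(y)` with `a ∈ C_c^∞((0, ∞))`
    have htest : ∀ a : ℝ → ℝ, ContDiff ℝ ∞ a → HasCompactSupport a → tsupport a ⊆ Ioi 0 →
        ∫ t, a t • (Fb t - Gb t) = 0 := by
      intro a ha hac haU
      set φ : ℝ × PhaseSpace N → ℝ := fun q => a q.1 * b q.2 with hφ
      have hφs : ContDiff ℝ ∞ φ := (ha.comp contDiff_fst).mul (hb.comp contDiff_snd)
      have hsupp : tsupport φ ⊆ tsupport a ×ˢ tsupport b := by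
        refine closure_minimal (fun q hq => ?_) ((isClosed_tsupport _).prod (isClosed_tsupport _))
        have h := Function.mem_support.1 hq
        exact ⟨subset_tsupport _ (Function.mem_support.2 (left_ne_zero_of_mul h)),
          subset_tsupport _ (Function.mem_support.2 (right_ne_zero_of_mul h))⟩
      have hφc : HasCompactSupport φ :=
        IsCompact.of_isClosed_subset (hac.isCompact.prod hbc.isCompact) (isClosed_tsupport _) hsupp
      have hφU : tsupport φ ⊆ U := hsupp.trans (prod_mono haU (subset_univ _))
      let Φ : 𝓓((⊤ : Opens (ℝ × PhaseSpace N)), ℝ) := ⟨φ, hφs, hφc, fun _ _ => trivial⟩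
      have hΦ := hgint Φ hφU
      rw [measureDistribution_apply] at hΦ
      -- left side: `∫ φ dm = ∫_{t>0} a(t) F_b(t) dt`
      have hintm : Integrable φ (S.spaceTimeLaw x) :=
        hφs.continuous.integrable_of_hasCompactSupport hφc
      have hleft : ∫ q, (Φ : ℝ × PhaseSpace N → ℝ) q ∂(S.spaceTimeLaw x) =
          ∫ t in Ioi (0 : ℝ), a t * Fb t := by
        change ∫ q, φ q ∂(S.spaceTimeLaw x) = _
        rw [S.integral_spaceTimeLaw x hintm]
        refine setIntegral_congr_fun measurableSet_Ioi fun t _ => ?_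
        simp only [hφ, hFb, MarkovSemigroupFor.act_apply]
        exact integral_const_mul (a t) b
      -- right side: `∫ g φ dvol = ∫ a(t) G_b(t) dt`
      have hgφc : Continuous fun q => g q * φ q := by
        refine continuous_iff_continuousAt.2 fun q => ?_
        by_cases hq : q ∈ U
        · exact (hgc.continuousAt (hUo.mem_nhds hq)).mul hφs.continuous.continuousAt
        · have hq' : q ∉ tsupport φ := fun h => hq (hφU h)
          have h0 : (fun q => g q * φ q) =ᶠ[𝓝 q] fun _ => 0 := by
            have hopen : IsOpen (tsupport φ)ᶜ := (isClosed_tsupport φ).isOpen_compl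
            filter_upwards [hopen.mem_nhds hq'] with r hr
            rw [image_eq_zero_of_notMem_tsupport hr, mul_zero]
          exact h0.continuousAt
      have hgφi : Integrable (fun q => g q * φ q) (volume : Measure (ℝ × PhaseSpace N)) :=
        hgφc.integrable_of_hasCompactSupport (show HasCompactSupport (g * φ) from hφc.mul_left)
      have hright : ∫ q, g q * (Φ : ℝ × PhaseSpace N → ℝ) q ∂(volume : Measure (ℝ × PhaseSpace N)) =
          ∫ t in Ioi (0 : ℝ), a t * Gb t := by
        change ∫ q, g q * φ q ∂(volume : Measure (ℝ × PhaseSpace N)) = _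
        rw [show (volume : Measure (ℝ × PhaseSpace N)) = (volume : Measure ℝ).prod volume from rfl,
          integral_prod _ hgφi]
        rw [← setIntegral_eq_integral_of_forall_compl_eq_zero (s := Ioi (0 : ℝ)) fun t ht => ?_]
        · refine setIntegral_congr_fun measurableSet_Ioi fun t _ => ?_
          simp only [hφ, hGb]
          rw [← integral_const_mul]
          refine integral_congr_ae (Eventually.of_forall fun y => ?_)
          simp only
          ring
        · have hat : a t = 0 := image_eq_zero_of_notMem_tsupport fun h => ht (haU h)
          simp [hφ, hat]
      have heq : ∫ t in Ioi (0 : ℝ), a t * Fb t = ∫ t in Ioi (0 : ℝ), a t * Gb t := by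
        rw [← hleft, ← hright]; exact hΦ
      -- conclude
      have hvan : ∀ {Hb : ℝ → ℝ}, ∀ t ∈ Ioi (0 : ℝ) \ tsupport a, a t * Hb t = 0 := fun t ht => by
        rw [image_eq_zero_of_notMem_tsupport ht.2, zero_mul]
      have hFi : IntegrableOn (fun t => a t * Fb t) (Ioi 0) volume :=
        (((ha.continuous.continuousOn).mul (hFc.mono haU)).integrableOn_compact hac.isCompact)
          |>.of_forall_sdiff_eq_zero measurableSet_Ioi hvan
      have hGi : IntegrableOn (fun t => a t * Gb t) (Ioi 0) volume :=
        (((ha.continuous.continuousOn).mul (hGc.mono haU)).integrableOn_compact hac.isCompact)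
          |>.of_forall_sdiff_eq_zero measurableSet_Ioi hvan
      rw [← setIntegral_eq_integral_of_forall_compl_eq_zero (s := Ioi (0 : ℝ)) fun t ht => by
        have hat : a t = 0 := image_eq_zero_of_notMem_tsupport fun h => ht (haU h)
        simp [hat]]
      simp only [smul_eq_mul, mul_sub]
      rw [integral_sub hFi hGi, heq, sub_self]
    -- a.e. equality on `(0, ∞)`, then everywhere by continuity
    have hae := isOpen_Ioi.ae_eq_zero_of_integral_contDiff_smul_eq_zero
      ((hFc.sub hGc).locallyIntegrableOn measurableSet_Ioi) htest
    have hae' : Fb =ᵐ[volume.restrict (Ioi (0 : ℝ))] Gb :=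
      (ae_restrict_iff' measurableSet_Ioi).2 (hae.mono fun t ht htI => sub_eq_zero.1 (ht htI))
    have hEq : EqOn Fb Gb (Ioi 0) := Measure.eqOn_open_of_ae_eq hae' isOpen_Ioi hFc hGc
    exact fun t ht => hEq ht
  -- slicing: every `P_t(x, ·)`, `t > 0`, has the density `g(t, ·) ≥ 0`
  have hboth : ∀ t : ℝ, 0 < t → (∀ y, 0 ≤ g (t, y)) ∧
      S.kernel t.toNNReal x = (volume : Measure (PhaseSpace N)).withDensity
        fun y => ENNReal.ofReal (g (t, y)) := fun t ht =>
    eq_withDensity_of_forall_integral_eq (m := S.kernel t.toNNReal x) volume (hslice_cont t ht)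
      fun b hb hbc => hkey hb hbc t ht
  refine ⟨fun t ht => (hboth t ht).1, fun t ht => ?_⟩
  have h := (hboth t (by exact_mod_cast ht)).2
  rwa [Real.toNNReal_coe] at h


end OscillatorChain

end Literature.MathematicalPhysics.KineticTheory.HeatConduction
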